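import Mathlib
import Summits.MatrixMultiplication.MatrixMultiplication.Theorems.SubgroupIdentityDesigns.Negative.SingerCycle
import Summits.MatrixMultiplication.MatrixMultiplication.Theorems.SubgroupIdentityDesigns.Negative.DesignConj

/-!
# Conjugate Singer cycles: a member containing `x · C_ns · x⁻¹` (all six placements)

Route `LevelGradedCohnUmans`, crux `SubgroupIdentityDesigns`, the `(m,k) = (2,1)` cell, `p`-free
case.  `SingerCycle` excludes the level-`1` identity design when a member contains the STANDARD
Singer cycle `K = {[[x, n y],[y, x]]}` and another member has a non-trivial element outside `K`.
Level-`1` designs are transported along conjugation of the whole triple (`DesignConj`), so the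
same holds for a member containing ANY conjugate `x K x⁻¹`, i.e. any cyclic subgroup of order
`p² - 1` acting irreducibly (every non-split maximal torus of `GL₂(𝔽_p)` is conjugate to `K`):
`no_levelOne_design_of_singer_conj₂₁/₃₁/₃₂/₁₂/₁₃/₂₃`, stated with the conjugator `x` explicit
(`x k x⁻¹ ∈ Hᵢ` for `k ∈ K`, `x k₀ x⁻¹ ∈ Hⱼ`, `k₀ ∉ K`).  `p` odd (a non-square `n`); no TPP, no
volume hypothesis.  VALUE = THEOREM, NOT summit progress; the crux item
stmt-MatrixMultiplication-14079 is untouched and remains open.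
-/

set_option linter.dupNamespace false

noncomputable section

open scoped BigOperators Classical

open Summit.MatrixMultiplication.MatrixMultiplication.Theorems.LieRankDesigns.Negative (GLm Mat)

namespace Summit.MatrixMultiplication.MatrixMultiplication.Theorems.SubgroupIdentityDesigns.Negative

section SingerConj

variable {p : ℕ} [hp : Fact p.Prime]

omit hp in
/-- Membership transport: `x k x⁻¹ ∈ H` gives `k ∈ H.map (conj x⁻¹)`. -/
theorem mem_map_conj_inv_of_conj_mem (H : Subgroup (GLm p 2)) (x k : GLm p 2)
    (hk : x * k * x⁻¹ ∈ H) : k ∈ H.map (MulAut.conj x⁻¹).toMonoidHom :=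
  Subgroup.mem_map.mpr ⟨x * k * x⁻¹, hk, by
    simp only [MulEquiv.coe_toMonoidHom, MulAut.conj_apply, inv_inv]; group⟩

/-- **Conjugate Singer cycle in `H₂`, a conjugate element of `H₁` outside it ⇒ no
level-one identity design** (`p` odd; no TPP). -/
theorem no_levelOne_design_of_singer_conj₂₁ {H₁ H₂ H₃ : Subgroup (GLm p 2)}
    (n : ZMod p) (hn : ∀ x : ZMod p, x * x ≠ n) (K : Subgroup (GLm p 2))
    (hKshape : ∀ k ∈ K, ((k : GLm p 2) : Mat p 2) 0 1 = n * ((k : GLm p 2) : Mat p 2) 1 0 ∧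
      ((k : GLm p 2) : Mat p 2) 1 1 = ((k : GLm p 2) : Mat p 2) 0 0)
    (hKall : ∀ k : GLm p 2, (k : Mat p 2) 0 1 = n * (k : Mat p 2) 1 0 →
      (k : Mat p 2) 1 1 = (k : Mat p 2) 0 0 → k ∈ K)
    (x : GLm p 2) (hKH : ∀ k ∈ K, x * k * x⁻¹ ∈ H₂) (k₀ : GLm p 2) (hk₀ : x * k₀ * x⁻¹ ∈ H₁)
    (hk₀K : k₀ ∉ K) :
    ¬ ∃ c : Mat p 2 → ℂ, (∀ M, 1 < M.rank → c M = 0) ∧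
      (∑ M, c M * ZMod.stdAddChar (Matrix.trace (M * ((1 : GLm p 2) : Mat p 2)))) = 1 ∧
      ∀ a ∈ H₁, ∀ b ∈ H₂, ∀ g ∈ H₃, a * b * g ≠ 1 →
        (∑ M, c M *
          ZMod.stdAddChar (Matrix.trace (M * ((a * b * g : GLm p 2) : Mat p 2)))) = 0 := by
  intro h
  exact no_levelOne_design_of_singer₂₁ (H₁ := H₁.map (MulAut.conj x⁻¹).toMonoidHom)
    (H₂ := H₂.map (MulAut.conj x⁻¹).toMonoidHom) (H₃ := H₃.map (MulAut.conj x⁻¹).toMonoidHom)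
    n hn K hKshape hKall (fun k hk => mem_map_conj_inv_of_conj_mem H₂ x k (hKH k hk)) k₀
    (mem_map_conj_inv_of_conj_mem H₁ x k₀ hk₀) hk₀K (DesignConj.design_conj H₁ H₂ H₃ x⁻¹ h)

/-- **Conjugate Singer cycle in `H₃`, a conjugate element of `H₁` outside it ⇒ no
level-one identity design** (`p` odd; no TPP). -/
theorem no_levelOne_design_of_singer_conj₃₁ {H₁ H₂ H₃ : Subgroup (GLm p 2)}
    (n : ZMod p) (hn : ∀ x : ZMod p, x * x ≠ n) (K : Subgroup (GLm p 2))
    (hKshape : ∀ k ∈ K, ((k : GLm p 2) : Mat p 2) 0 1 = n * ((k : GLm p 2) : Mat p 2) 1 0 ∧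
      ((k : GLm p 2) : Mat p 2) 1 1 = ((k : GLm p 2) : Mat p 2) 0 0)
    (hKall : ∀ k : GLm p 2, (k : Mat p 2) 0 1 = n * (k : Mat p 2) 1 0 →
      (k : Mat p 2) 1 1 = (k : Mat p 2) 0 0 → k ∈ K)
    (x : GLm p 2) (hKH : ∀ k ∈ K, x * k * x⁻¹ ∈ H₃) (k₀ : GLm p 2) (hk₀ : x * k₀ * x⁻¹ ∈ H₁)
    (hk₀K : k₀ ∉ K) :
    ¬ ∃ c : Mat p 2 → ℂ, (∀ M, 1 < M.rank → c M = 0) ∧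
      (∑ M, c M * ZMod.stdAddChar (Matrix.trace (M * ((1 : GLm p 2) : Mat p 2)))) = 1 ∧
      ∀ a ∈ H₁, ∀ b ∈ H₂, ∀ g ∈ H₃, a * b * g ≠ 1 →
        (∑ M, c M *
          ZMod.stdAddChar (Matrix.trace (M * ((a * b * g : GLm p 2) : Mat p 2)))) = 0 := by
  intro h
  exact no_levelOne_design_of_singer₃₁ (H₁ := H₁.map (MulAut.conj x⁻¹).toMonoidHom)
    (H₂ := H₂.map (MulAut.conj x⁻¹).toMonoidHom) (H₃ := H₃.map (MulAut.conj x⁻¹).toMonoidHom)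
    n hn K hKshape hKall (fun k hk => mem_map_conj_inv_of_conj_mem H₃ x k (hKH k hk)) k₀
    (mem_map_conj_inv_of_conj_mem H₁ x k₀ hk₀) hk₀K (DesignConj.design_conj H₁ H₂ H₃ x⁻¹ h)

/-- **Conjugate Singer cycle in `H₃`, a conjugate element of `H₂` outside it ⇒ no
level-one identity design** (`p` odd; no TPP). -/
theorem no_levelOne_design_of_singer_conj₃₂ {H₁ H₂ H₃ : Subgroup (GLm p 2)}
    (n : ZMod p) (hn : ∀ x : ZMod p, x * x ≠ n) (K : Subgroup (GLm p 2))
    (hKshape : ∀ k ∈ K, ((k : GLm p 2) : Mat p 2) 0 1 = n * ((k : GLm p 2) : Mat p 2) 1 0 ∧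
      ((k : GLm p 2) : Mat p 2) 1 1 = ((k : GLm p 2) : Mat p 2) 0 0)
    (hKall : ∀ k : GLm p 2, (k : Mat p 2) 0 1 = n * (k : Mat p 2) 1 0 →
      (k : Mat p 2) 1 1 = (k : Mat p 2) 0 0 → k ∈ K)
    (x : GLm p 2) (hKH : ∀ k ∈ K, x * k * x⁻¹ ∈ H₃) (k₀ : GLm p 2) (hk₀ : x * k₀ * x⁻¹ ∈ H₂)
    (hk₀K : k₀ ∉ K) :
    ¬ ∃ c : Mat p 2 → ℂ, (∀ M, 1 < M.rank → c M = 0) ∧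
      (∑ M, c M * ZMod.stdAddChar (Matrix.trace (M * ((1 : GLm p 2) : Mat p 2)))) = 1 ∧
      ∀ a ∈ H₁, ∀ b ∈ H₂, ∀ g ∈ H₃, a * b * g ≠ 1 →
        (∑ M, c M *
          ZMod.stdAddChar (Matrix.trace (M * ((a * b * g : GLm p 2) : Mat p 2)))) = 0 := by
  intro h
  exact no_levelOne_design_of_singer₃₂ (H₁ := H₁.map (MulAut.conj x⁻¹).toMonoidHom)
    (H₂ := H₂.map (MulAut.conj x⁻¹).toMonoidHom) (H₃ := H₃.map (MulAut.conj x⁻¹).toMonoidHom)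
    n hn K hKshape hKall (fun k hk => mem_map_conj_inv_of_conj_mem H₃ x k (hKH k hk)) k₀
    (mem_map_conj_inv_of_conj_mem H₂ x k₀ hk₀) hk₀K (DesignConj.design_conj H₁ H₂ H₃ x⁻¹ h)

/-- **Conjugate Singer cycle in `H₁`, a conjugate element of `H₂` outside it ⇒ no
level-one identity design** (`p` odd; no TPP). -/
theorem no_levelOne_design_of_singer_conj₁₂ {H₁ H₂ H₃ : Subgroup (GLm p 2)}
    (n : ZMod p) (hn : ∀ x : ZMod p, x * x ≠ n) (K : Subgroup (GLm p 2))
    (hKshape : ∀ k ∈ K, ((k : GLm p 2) : Mat p 2) 0 1 = n * ((k : GLm p 2) : Mat p 2) 1 0 ∧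
      ((k : GLm p 2) : Mat p 2) 1 1 = ((k : GLm p 2) : Mat p 2) 0 0)
    (hKall : ∀ k : GLm p 2, (k : Mat p 2) 0 1 = n * (k : Mat p 2) 1 0 →
      (k : Mat p 2) 1 1 = (k : Mat p 2) 0 0 → k ∈ K)
    (x : GLm p 2) (hKH : ∀ k ∈ K, x * k * x⁻¹ ∈ H₁) (k₀ : GLm p 2) (hk₀ : x * k₀ * x⁻¹ ∈ H₂)
    (hk₀K : k₀ ∉ K) :
    ¬ ∃ c : Mat p 2 → ℂ, (∀ M, 1 < M.rank → c M = 0) ∧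
      (∑ M, c M * ZMod.stdAddChar (Matrix.trace (M * ((1 : GLm p 2) : Mat p 2)))) = 1 ∧
      ∀ a ∈ H₁, ∀ b ∈ H₂, ∀ g ∈ H₃, a * b * g ≠ 1 →
        (∑ M, c M *
          ZMod.stdAddChar (Matrix.trace (M * ((a * b * g : GLm p 2) : Mat p 2)))) = 0 := by
  intro h
  exact no_levelOne_design_of_singer₁₂ (H₁ := H₁.map (MulAut.conj x⁻¹).toMonoidHom)
    (H₂ := H₂.map (MulAut.conj x⁻¹).toMonoidHom) (H₃ := H₃.map (MulAut.conj x⁻¹).toMonoidHom)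
    n hn K hKshape hKall (fun k hk => mem_map_conj_inv_of_conj_mem H₁ x k (hKH k hk)) k₀
    (mem_map_conj_inv_of_conj_mem H₂ x k₀ hk₀) hk₀K (DesignConj.design_conj H₁ H₂ H₃ x⁻¹ h)

/-- **Conjugate Singer cycle in `H₁`, a conjugate element of `H₃` outside it ⇒ no
level-one identity design** (`p` odd; no TPP). -/
theorem no_levelOne_design_of_singer_conj₁₃ {H₁ H₂ H₃ : Subgroup (GLm p 2)}
    (n : ZMod p) (hn : ∀ x : ZMod p, x * x ≠ n) (K : Subgroup (GLm p 2))
    (hKshape : ∀ k ∈ K, ((k : GLm p 2) : Mat p 2) 0 1 = n * ((k : GLm p 2) : Mat p 2) 1 0 ∧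
      ((k : GLm p 2) : Mat p 2) 1 1 = ((k : GLm p 2) : Mat p 2) 0 0)
    (hKall : ∀ k : GLm p 2, (k : Mat p 2) 0 1 = n * (k : Mat p 2) 1 0 →
      (k : Mat p 2) 1 1 = (k : Mat p 2) 0 0 → k ∈ K)
    (x : GLm p 2) (hKH : ∀ k ∈ K, x * k * x⁻¹ ∈ H₁) (k₀ : GLm p 2) (hk₀ : x * k₀ * x⁻¹ ∈ H₃)
    (hk₀K : k₀ ∉ K) :
    ¬ ∃ c : Mat p 2 → ℂ, (∀ M, 1 < M.rank → c M = 0) ∧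
      (∑ M, c M * ZMod.stdAddChar (Matrix.trace (M * ((1 : GLm p 2) : Mat p 2)))) = 1 ∧
      ∀ a ∈ H₁, ∀ b ∈ H₂, ∀ g ∈ H₃, a * b * g ≠ 1 →
        (∑ M, c M *
          ZMod.stdAddChar (Matrix.trace (M * ((a * b * g : GLm p 2) : Mat p 2)))) = 0 := by
  intro h
  exact no_levelOne_design_of_singer₁₃ (H₁ := H₁.map (MulAut.conj x⁻¹).toMonoidHom)
    (H₂ := H₂.map (MulAut.conj x⁻¹).toMonoidHom) (H₃ := H₃.map (MulAut.conj x⁻¹).toMonoidHom)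
    n hn K hKshape hKall (fun k hk => mem_map_conj_inv_of_conj_mem H₁ x k (hKH k hk)) k₀
    (mem_map_conj_inv_of_conj_mem H₃ x k₀ hk₀) hk₀K (DesignConj.design_conj H₁ H₂ H₃ x⁻¹ h)

/-- **Conjugate Singer cycle in `H₂`, a conjugate element of `H₃` outside it ⇒ no
level-one identity design** (`p` odd; no TPP). -/
theorem no_levelOne_design_of_singer_conj₂₃ {H₁ H₂ H₃ : Subgroup (GLm p 2)}
    (n : ZMod p) (hn : ∀ x : ZMod p, x * x ≠ n) (K : Subgroup (GLm p 2))
    (hKshape : ∀ k ∈ K, ((k : GLm p 2) : Mat p 2) 0 1 = n * ((k : GLm p 2) : Mat p 2) 1 0 ∧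
      ((k : GLm p 2) : Mat p 2) 1 1 = ((k : GLm p 2) : Mat p 2) 0 0)
    (hKall : ∀ k : GLm p 2, (k : Mat p 2) 0 1 = n * (k : Mat p 2) 1 0 →
      (k : Mat p 2) 1 1 = (k : Mat p 2) 0 0 → k ∈ K)
    (x : GLm p 2) (hKH : ∀ k ∈ K, x * k * x⁻¹ ∈ H₂) (k₀ : GLm p 2) (hk₀ : x * k₀ * x⁻¹ ∈ H₃)
    (hk₀K : k₀ ∉ K) :
    ¬ ∃ c : Mat p 2 → ℂ, (∀ M, 1 < M.rank → c M = 0) ∧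
      (∑ M, c M * ZMod.stdAddChar (Matrix.trace (M * ((1 : GLm p 2) : Mat p 2)))) = 1 ∧
      ∀ a ∈ H₁, ∀ b ∈ H₂, ∀ g ∈ H₃, a * b * g ≠ 1 →
        (∑ M, c M *
          ZMod.stdAddChar (Matrix.trace (M * ((a * b * g : GLm p 2) : Mat p 2)))) = 0 := by
  intro h
  exact no_levelOne_design_of_singer₂₃ (H₁ := H₁.map (MulAut.conj x⁻¹).toMonoidHom)
    (H₂ := H₂.map (MulAut.conj x⁻¹).toMonoidHom) (H₃ := H₃.map (MulAut.conj x⁻¹).toMonoidHom)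
    n hn K hKshape hKall (fun k hk => mem_map_conj_inv_of_conj_mem H₂ x k (hKH k hk)) k₀
    (mem_map_conj_inv_of_conj_mem H₃ x k₀ hk₀) hk₀K (DesignConj.design_conj H₁ H₂ H₃ x⁻¹ h)

end SingerConj

end Summit.MatrixMultiplication.MatrixMultiplication.Theorems.SubgroupIdentityDesigns.Negative

end
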